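import Summits.KontsevichZagierPeriods.Zeta5Search.LaiSweepShard

/-!
# `κ₃` sweep certificate — shard file 096 of 127 (shards 672–678 of 889)

HONEST FRAMING. Systematic search; no irrationality claim unless certified. This file only checks,
by `decide +kernel`, shards 672–678 of the order-cell sweep of the `κ₃` point `(74, 2180, 444; δ74)`
(engine `LaiSweepEngine`, soundness `LaiSweepJump/Free/Eval/Shard/Kappa3`; a shard is `⟨regime, n,
p, q, p', q', Lo, Up⟩`: `n` cells from `p/q` to `p'/q'` with integer rate sums in `[Lo, Up]`, `K =
128`, `D = 2^40`). It draws NO conclusion: only the capstone `LaiKappa3SweepCert`, which needs all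
127 shard files, does. Kernel cost of this file ≈ 560 cells × 0.3 s.
-/

namespace Summit.KontsevichZagierPeriods.Zeta5Search.Sweep

set_option maxHeartbeats 100000000 in
/-- Shard 672: 80 cells of regime B from `267/367` to `239/328`.
[cite: Lai2024BallRivoal, §4 Lemma 4.3] -/
theorem shard672 :
    Shard.check 128 (2^40)
      ⟨true, 80, 267, 367, 239, 328, 10648296708347, 15586019887043⟩ = true := by
  decide +kernel

set_option maxHeartbeats 100000000 in
/-- Shard 673: 80 cells of regime B from `239/328` to `273/374`.
[cite: Lai2024BallRivoal, §4 Lemma 4.3] -/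
theorem shard673 :
    Shard.check 128 (2^40)
      ⟨true, 80, 239, 328, 273, 374, 12044144415028, 17647116173649⟩ = true := by
  decide +kernel

set_option maxHeartbeats 100000000 in
/-- Shard 674: 80 cells of regime B from `273/374` to `321/439`.
[cite: Lai2024BallRivoal, §4 Lemma 4.3] -/
theorem shard674 :
    Shard.check 128 (2^40)
      ⟨true, 80, 273, 374, 321, 439, 11773626634599, 17269185870395⟩ = true := by
  decide +kernel

set_option maxHeartbeats 100000000 in
/-- Shard 675: 80 cells of regime B from `321/439` to `271/370`.
[cite: Lai2024BallRivoal, §4 Lemma 4.3] -/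
theorem shard675 :
    Shard.check 128 (2^40)
      ⟨true, 80, 321, 439, 271, 370, 11425729561514, 16776287066369⟩ = true := by
  decide +kernel

set_option maxHeartbeats 100000000 in
/-- Shard 676: 80 cells of regime B from `271/370` to `259/353`.
[cite: Lai2024BallRivoal, §4 Lemma 4.3] -/
theorem shard676 :
    Shard.check 128 (2^40)
      ⟨true, 80, 271, 370, 259, 353, 11913126699560, 17510531185278⟩ = true := by
  decide +kernel

set_option maxHeartbeats 100000000 in
/-- Shard 677: 80 cells of regime B from `259/353` to `269/366`.
[cite: Lai2024BallRivoal, §4 Lemma 4.3] -/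
theorem shard677 :
    Shard.check 128 (2^40)
      ⟨true, 80, 259, 353, 269, 366, 11749559566615, 17288203150555⟩ = true := by
  decide +kernel

set_option maxHeartbeats 100000000 in
/-- Shard 678: 80 cells of regime B from `269/366` to `307/417`.
[cite: Lai2024BallRivoal, §4 Lemma 4.3] -/
theorem shard678 :
    Shard.check 128 (2^40)
      ⟨true, 80, 269, 366, 307, 417, 11515464733660, 16961530197782⟩ = true := by
  decide +kernel

/-- The checked shards of this file, in order. [folklore] -/
def shards096 : List (CheckedShard 128 (2^40)) :=
  [⟨_, shard672⟩, ⟨_, shard673⟩, ⟨_, shard674⟩, ⟨_, shard675⟩, ⟨_, shard676⟩,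
    ⟨_, shard677⟩, ⟨_, shard678⟩]

end Summit.KontsevichZagierPeriods.Zeta5Search.Sweep
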